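import Literature.AlgebraicGeometry.Motives.FaltingsTateIsogenyInvariance
import Literature.AlgebraicGeometry.Motives.AbelianVarietyBiproductTateModuleProofs
import HarnessLib

/-!
# [Faltings 1983, §5 Kor. 1] is additive in both arguments

Theorems only (topic `AlgebraicGeometry/Motives`; no definition, no named fact, no instance).

The statement `faltings_tate_bijective A B ℓ` ([Fal83 §5 Kor. 1]: the Tate map
`ℤ_ℓ ⊗ Hom_K(A, B) → Hom_{Γ_K}(T_ℓ A, T_ℓ B)` is bijective over a number field) passes to binary
biproducts in EACH variable: if it holds for `(A₁, B)` and `(A₂, B)` then it holds for `(A₁ ⊞ A₂, B)`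
(`faltings_tate_bijective_biprod_left`), and symmetrically in `B` (`…_biprod_right`,
`…_biprod_biprod`) — the converse of the Zarhin corner `faltings_tate_bijective_of_end_biprod`
(`FaltingsAbelianProofs`).  SURJECTIVITY: an equivariant `g : T_ℓ(A₁ ⊞ A₂) → T_ℓ B` is
`g ∘ T_ℓ(inl) ∘ T_ℓ(fst) + g ∘ T_ℓ(inr) ∘ T_ℓ(snd)` (`T_ℓ` is additive,
`tateModuleMap_bicone_total`), and `g ∘ T_ℓ(inl)` is equivariant into the span of the `T_ℓ f`,
`f ∈ Hom(A₁, B)` (`toLinearMap_mem_span_of_surjective`), a span stable under `∘ T_ℓ(fst)`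
(`mem_span_tateModuleMap_comp_of_mem_span`); then `surjective_faltingsTateMap_of_forall_mem_span`.
INJECTIVITY is Mumford §19 Thm. 3 for every pair (`faltingsTateMap_injective_holds`).  Kieffer 2024
§1.2.2 p. 22: `Hom(A × B, C) = Hom(A, C) ⊕ Hom(B, C)` on both sides of the Tate map.

## References

* [Faltings1983Endlichkeit] G. Faltings, Invent. Math. 73 (1983), §5 Korollar 1.
* [MumfordAV1970] D. Mumford, *Abelian Varieties* (1970), §19 Theorem 3 and p. 176.
* [Kieffer2024IsogenyGraphs] J. Kieffer (2024), §1.2.2 p. 22.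
-/

noncomputable section

universe u

open CategoryTheory CategoryTheory.Limits
open scoped TensorProduct

namespace Literature.AlgebraicGeometry.Motives

namespace AbelianVariety

variable {K : Type u} [Field K] {A A₁ A₂ B B₁ B₂ : AbelianVariety K} (ℓ : ℕ) [Fact ℓ.Prime]

/-- **Surjectivity of the Tate map is additive in the source**: if `ℤ_ℓ ⊗ Hom(A_i, B) → Hom_Γ(T_ℓ A_i, T_ℓ B)`
is onto for `i = 1, 2`, then so is `ℤ_ℓ ⊗ Hom(A₁ ⊞ A₂, B) → Hom_Γ(T_ℓ(A₁ ⊞ A₂), T_ℓ B)`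
(`g = g T(inl) T(fst) + g T(inr) T(snd)`, each summand in the span of the `T_ℓ h`).
[cite: MumfordAV1970, §19 Theorem 3 (p. 176, additivity of `T_ℓ`)] [cite: Kieffer2024IsogenyGraphs, §1.2.2 p. 22] -/
theorem surjective_faltingsTateMap_biprod_left (A₁ A₂ B : AbelianVariety K)
    (h₁ : Function.Surjective (faltingsTateMap A₁ B ℓ))
    (h₂ : Function.Surjective (faltingsTateMap A₂ B ℓ)) :
    Function.Surjective (faltingsTateMap (A₁ ⊞ A₂) B ℓ) := by
  refine surjective_faltingsTateMap_of_forall_mem_span ℓ fun g ↦ ?_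
  have hg₁ := mem_span_tateModuleMap_comp_of_mem_span ℓ (biprod.fst : A₁ ⊞ A₂ ⟶ A₁)
    (toLinearMap_mem_span_of_surjective ℓ h₁ (g.comp (tateIntertwiningMap ℓ biprod.inl)))
  have hg₂ := mem_span_tateModuleMap_comp_of_mem_span ℓ (biprod.snd : A₁ ⊞ A₂ ⟶ A₂)
    (toLinearMap_mem_span_of_surjective ℓ h₂ (g.comp (tateIntertwiningMap ℓ biprod.inr)))
  have htot := tateModuleMap_bicone_total ℓ (BinaryBiproduct.bicone A₁ A₂) biprod.total
  have hsum : g.toLinearMap =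
      (g.comp (tateIntertwiningMap ℓ biprod.inl)).toLinearMap.comp (tateModuleMap ℓ biprod.fst) +
        (g.comp (tateIntertwiningMap ℓ biprod.inr)).toLinearMap.comp (tateModuleMap ℓ biprod.snd) := by
    rw [Representation.IntertwiningMap.comp_toLinearMap, Representation.IntertwiningMap.comp_toLinearMap,
      toLinearMap_tateIntertwiningMap, toLinearMap_tateIntertwiningMap, LinearMap.comp_assoc,
      LinearMap.comp_assoc, ← LinearMap.comp_add]
    erw [htot, LinearMap.comp_id]
  rw [hsum]
  exact add_mem hg₁ hg₂

/-- **Surjectivity of the Tate map is additive in the target**: if `ℤ_ℓ ⊗ Hom(A, B_j) → Hom_Γ(T_ℓ A, T_ℓ B_j)`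
is onto for `j = 1, 2`, then so is `ℤ_ℓ ⊗ Hom(A, B₁ ⊞ B₂) → Hom_Γ(T_ℓ A, T_ℓ(B₁ ⊞ B₂))`
(`g = T(inl) T(fst) g + T(inr) T(snd) g`). [cite: MumfordAV1970, §19 Theorem 3 (p. 176, additivity of `T_ℓ`)]
[cite: Kieffer2024IsogenyGraphs, §1.2.2 p. 22] -/
theorem surjective_faltingsTateMap_biprod_right (A B₁ B₂ : AbelianVariety K)
    (h₁ : Function.Surjective (faltingsTateMap A B₁ ℓ))
    (h₂ : Function.Surjective (faltingsTateMap A B₂ ℓ)) :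
    Function.Surjective (faltingsTateMap A (B₁ ⊞ B₂) ℓ) := by
  refine surjective_faltingsTateMap_of_forall_mem_span ℓ fun g ↦ ?_
  have hg₁ := comp_mem_span_tateModuleMap_of_mem_span ℓ (biprod.inl : B₁ ⟶ B₁ ⊞ B₂)
    (toLinearMap_mem_span_of_surjective ℓ h₁ ((tateIntertwiningMap ℓ biprod.fst).comp g))
  have hg₂ := comp_mem_span_tateModuleMap_of_mem_span ℓ (biprod.inr : B₂ ⟶ B₁ ⊞ B₂)
    (toLinearMap_mem_span_of_surjective ℓ h₂ ((tateIntertwiningMap ℓ biprod.snd).comp g))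
  have htot := tateModuleMap_bicone_total ℓ (BinaryBiproduct.bicone B₁ B₂) biprod.total
  have hsum : g.toLinearMap =
      (tateModuleMap ℓ biprod.inl).comp ((tateIntertwiningMap ℓ biprod.fst).comp g).toLinearMap +
        (tateModuleMap ℓ biprod.inr).comp ((tateIntertwiningMap ℓ biprod.snd).comp g).toLinearMap := by
    rw [Representation.IntertwiningMap.comp_toLinearMap, Representation.IntertwiningMap.comp_toLinearMap,
      toLinearMap_tateIntertwiningMap, toLinearMap_tateIntertwiningMap, ← LinearMap.comp_assoc,
      ← LinearMap.comp_assoc, ← LinearMap.add_comp]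
    erw [htot, LinearMap.id_comp]
  rw [hsum]
  exact add_mem hg₁ hg₂

/-- **[Fal83 §5 Kor. 1] is additive in the source**: `faltings_tate_bijective A₁ B ℓ` and
`faltings_tate_bijective A₂ B ℓ` imply `faltings_tate_bijective (A₁ ⊞ A₂) B ℓ` (surjectivity by
`surjective_faltingsTateMap_biprod_left`; injectivity is Mumford §19 Thm. 3,
`faltingsTateMap_injective_holds`). [cite: Faltings1983Endlichkeit, §5 Korollar 1]
[cite: MumfordAV1970, §19 Theorem 3] -/
theorem faltings_tate_bijective_biprod_left (A₁ A₂ B : AbelianVariety K)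
    (h₁ : faltings_tate_bijective A₁ B ℓ) (h₂ : faltings_tate_bijective A₂ B ℓ) :
    faltings_tate_bijective (A₁ ⊞ A₂) B ℓ := fun {_} ↦
  ⟨faltingsTateMap_injective_holds _ _ ℓ (natCast_ne_zero_of_numberField ℓ),
    surjective_faltingsTateMap_biprod_left ℓ A₁ A₂ B h₁.2 h₂.2⟩

/-- **[Fal83 §5 Kor. 1] is additive in the target**: `faltings_tate_bijective A B₁ ℓ` and
`faltings_tate_bijective A B₂ ℓ` imply `faltings_tate_bijective A (B₁ ⊞ B₂) ℓ`.
[cite: Faltings1983Endlichkeit, §5 Korollar 1] [cite: MumfordAV1970, §19 Theorem 3] -/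
theorem faltings_tate_bijective_biprod_right (A B₁ B₂ : AbelianVariety K)
    (h₁ : faltings_tate_bijective A B₁ ℓ) (h₂ : faltings_tate_bijective A B₂ ℓ) :
    faltings_tate_bijective A (B₁ ⊞ B₂) ℓ := fun {_} ↦
  ⟨faltingsTateMap_injective_holds _ _ ℓ (natCast_ne_zero_of_numberField ℓ),
    surjective_faltingsTateMap_biprod_right ℓ A B₁ B₂ h₁.2 h₂.2⟩

/-- **[Fal83 §5 Kor. 1] for a pair of binary biproducts from the four corners**:
`faltings_tate_bijective (A₁ ⊞ A₂) (B₁ ⊞ B₂) ℓ` from the statement for `(A_i, B_j)`, `i, j ∈ {1, 2}`.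
[cite: Faltings1983Endlichkeit, §5 Korollar 1] [cite: Kieffer2024IsogenyGraphs, §1.2.2 p. 22] -/
theorem faltings_tate_bijective_biprod_biprod (A₁ A₂ B₁ B₂ : AbelianVariety K)
    (h₁₁ : faltings_tate_bijective A₁ B₁ ℓ) (h₁₂ : faltings_tate_bijective A₁ B₂ ℓ)
    (h₂₁ : faltings_tate_bijective A₂ B₁ ℓ) (h₂₂ : faltings_tate_bijective A₂ B₂ ℓ) :
    faltings_tate_bijective (A₁ ⊞ A₂) (B₁ ⊞ B₂) ℓ :=
  faltings_tate_bijective_biprod_left ℓ A₁ A₂ (B₁ ⊞ B₂)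
    (faltings_tate_bijective_biprod_right ℓ A₁ B₁ B₂ h₁₁ h₁₂)
    (faltings_tate_bijective_biprod_right ℓ A₂ B₁ B₂ h₂₁ h₂₂)

end AbelianVariety

end Literature.AlgebraicGeometry.Motives

end
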